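import Mathlib
import Summits.Ventures.HodgeRepro2.HeckeEigenformsUnconditional
import Summits.Ventures.HodgeRepro2.HeckeSlashDoubleCoset

/-!
# NonVanishingSelfAdjointEigenform — a Tier-3 input gives an eigenform of ONE Hecke operator `T_δ`
with non-zero (N)-period, under the double-coset condition `SδS = Sδ⁻¹S` alone

Blind cell `pub-hodge-repro2`, seat p2 (Tier 5 kernel support, Hecke side).

`NonVanishingHeckeEigenform.lean` / `HeckeEigenformsUnconditional.lean` produce, from a Tier-3
input, a simultaneous eigenform of an inversion-closed COMMUTING family of Hecke operators with
non-zero projection of the vertex form. For a single operator `T_δ` no commutation is needed: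
`HeckeSlashDoubleCoset.lean` gives `T_δ = T_{δ⁻¹}` when `SδS = Sδ⁻¹S`, so the two-element family
`{δ, δ⁻¹}` (closed under inversion, trivially commuting) is admissible. Hence:

* **`NonVanishingInput.exists_hecke_eigenform_of_doubleCoset_eq_inv`**: under the Tier-3 input,
  for EVERY rational unitary `δ` with `S'δS' = S'δ⁻¹S'` there is a holomorphic weight-`3` form `v`,
  `‖v‖ = 1`, which is a `T_δ`-eigenform and has `⟨v, f⟩_Pet ≠ 0` for the vertex form `f` —
  the only remaining hypothesis on the Hecke side is the double-coset identity.
-/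

namespace Summit.Ventures.HodgeRepro2.ShimuraData

open MeasureTheory

variable {K : Type*} [Field K] [NumberField K] [NumberField.IsCMField K] {τ₁ : K →+* ℂ}
  {H : Matrix (Fin 3) (Fin 3) K} {Q : Matrix (Fin 3) (Fin 3) ℂ} {𝔪 : Submodule ℤ (Fin 3 → K)}

/-- **Eigenform of a single Hecke operator with non-zero (N)-period, under `SδS = Sδ⁻¹S` only.**
From a Tier-3 input: a congruence subgroup `S' ⊆ Γ_N`, torsion-free, of finite index in `Γ_1`, with
compact quotient and a measurable fundamental domain `D`, and a holomorphic weight-`3` form `f ≢ 0`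
such that for every rational unitary `δ` with `S'δS' = S'δ⁻¹S'` there is a unit holomorphic form
`v` which is a `T_δ`-eigenform with `⟨v, f⟩_Pet ≠ 0`. -/
theorem NonVanishingInput.exists_hecke_eigenform_of_doubleCoset_eq_inv (hH : IsHermitianForm K H)
    (hdef : ∀ τ : K →+* ℂ, NumberField.InfinitePlace.mk τ ≠ NumberField.InfinitePlace.mk τ₁ →
      IsDefiniteAt K τ H)
    (hQ : IsFrame K τ₁ H Q) (h𝔪 : IsLattice K 𝔪) (hnv : NonVanishingInput K τ₁ H 𝔪 Q) {N : ℕ}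
    (hN : 2 < N)
    [CompactSpace (ballQuotient hQ (shimuraLevelSubgroup K H 𝔪 1)
      (shimuraLevelSubgroup_one_subset_unitaryGroup H 𝔪))] :
    ∃ S' : Subgroup (GL (Fin 3) K), ∃ hS' : (S' : Set (GL (Fin 3) K)) ⊆ shimuraLevel K H 𝔪 N,
      IsTorsionFreeSet K (S' : Set (GL (Fin 3) K)) ∧
      ∃ hS₁ : S' ≤ shimuraLevelSubgroup K H 𝔪 1,
      ∃ hfin : (S'.subgroupOf (shimuraLevelSubgroup K H 𝔪 1)).FiniteIndex,
      ∃ _hc : CompactSpace (ballQuotient hQ S' (subset_unitaryGroup_of_subset_shimuraLevel hS')),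
      ∃ D : Set ball₂, ∃ hDm : MeasurableSet D,
      ∃ hD : IsBallFundamentalDomain hQ S' (subset_unitaryGroup_of_subset_shimuraLevel hS') D,
      ∃ f : PeterssonForms hQ S' (subset_unitaryGroup_of_subset_shimuraLevel hS') 3 hD,
        f ∈ holomorphicForms hQ S' _ 3 hD ∧
        (SeparationQuotient.mk f : PeterssonSpace hQ S' _ 3 hD) ≠ 0 ∧
        ∀ δ : unitaryGroup K H,
          doubleCoset S' (δ : GL (Fin 3) K) = doubleCoset S' ((δ : GL (Fin 3) K)⁻¹) →
          ∃ v : PeterssonSpace hQ S' _ 3 hD, v ∈ holomorphicSpace hQ S' _ 3 hD ∧ ‖v‖ = 1 ∧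
            (∃ μ : ℂ, heckeFamilyOf hQ S' _ 3 hD hDm
              (fun δ => fintypeHeckeQuotientOfFiniteIndex h𝔪 hS₁ hfin δ.2) δ v = μ • v) ∧
            inner ℂ v (SeparationQuotient.mk f : PeterssonSpace hQ S' _ 3 hD) ≠ 0 := by
  obtain ⟨S', hS', htf, hS₁, hfin, hc, D, hDm, hD, f, hfhol, hfne, hmain⟩ :=
    hnv.exists_hecke_eigenform_unconditional hH hdef hQ h𝔪 hN
  refine ⟨S', hS', htf, hS₁, hfin, hc, D, hDm, hD, f, hfhol, hfne, ?_⟩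
  intro δ hdc
  haveI := hc
  set inst : ∀ δ : unitaryGroup K H,
      Fintype (S' ⧸ (heckeSubgroup S' (δ : GL (Fin 3) K)).subgroupOf S') :=
    fun δ => fintypeHeckeQuotientOfFiniteIndex h𝔪 hS₁ hfin δ.2 with hinst
  set T := heckeFamilyOf hQ S' (subset_unitaryGroup_of_subset_shimuraLevel hS') 3 hD hDm inst
    with hTdef
  -- `T_δ = T_{δ⁻¹}` from the double-coset identity
  have hTeq : T δ = T δ⁻¹ :=
    heckeFamilyOf_eq_inv_of_doubleCoset_eq hQ S' (subset_unitaryGroup_of_subset_shimuraLevel hS')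
      3 hD hDm inst hdc
  -- the two-element family `{δ, δ⁻¹}`, closed under inversion, commuting since `T_δ = T_{δ⁻¹}`
  let fam : Bool → unitaryGroup K H := fun b => match b with
    | true => δ
    | false => δ⁻¹
  have hσ : ∀ b, fam (!b) = (fam b)⁻¹ := by
    intro b
    cases b
    · show δ = (δ⁻¹)⁻¹
      rw [inv_inv]
    · rfl
  have hT : ∀ b, T (fam b) = T δ := by
    intro b
    cases b
    · exact hTeq.symm
    · rfl
  have hcomm : ∀ i j, Commute (T (fam i)) (T (fam j)) := by
    intro i j
    rw [hT i, hT j]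
  obtain ⟨v, hv, hnorm, heig, hinner⟩ := hmain Bool fam (fun b => !b) hσ hcomm
  exact ⟨v, hv, hnorm, heig true, hinner⟩

end Summit.Ventures.HodgeRepro2.ShimuraData
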